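import Summits.ResolutionOfSingularities.ResolutionOfSingularities.Theorems.FrobeniusClosingSteerToricConcl
import Literature.RingTheory.KrullDimension.AffineCatenary
import Literature.RingTheory.KrullDimension.TranscendenceDegreeOfPoint
import Literature.AlgebraicGeometry.Resolution.RegularLocalRingsQuotient
import HarnessLib

/-!
# Crux `Steer` (stmt-ResolutionOfSingularities-16345) — §σ2.28 PROVER'S TOOL: the TORIC EXIT CRITERION (Jacobian unit in a monomial chart)

OURS (campaign res-hironaka, rung L ★L-G4, slot W4.1, chain w41; res-type-028 g10 on res-L0-w41-plan-1 RULING 121b; statement file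
`L/res-type-028/ToricExitCriterion.statement.lean` 953a0c568e4715e8, confirmed by res-L0-w41-strat-2 §12 12:45:17Z). Theses-free;
`--supports stmt-ResolutionOfSingularities-16345`, counted 0. NOT a statement of the manuscript under review
[claim: Hironaka2017, status: under-review]; AI seat, weaker than expert review. Mathematics: the Jacobian criterion for a hypersurface
in a smooth toric chart, member-relative to a valuation ring.

THE CUT. `ToricExitAt O R s n N` (skeleton r38 l.4953, res-L0-w41-strat-2 §σ2.28 (a)) asks, for a member `R N` with a regular system of
parameters `x` and a unimodular `m` on the letters `y = (s N, x)` with all `z_j = y^{m_j} ∈ O`, that the local ring at the centre of `O`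
of `(R N)[s N][z]` be REGULAR. For a MONOMIAL-TYPE member (`R N = locAtCentre k[x] O`, `x` algebraically independent — every member of
a torus-fixed run, e.g. specimens F, G, f♮ of res-L0-w41-tri-3) and a cone INSIDE THE POSITIVE ORTHANT (`m⁻¹ ≥ 0`: every letter is an
`ℕ`-monomial in `z`), that local ring IS `locAtCentre k[z] O`, `k[z] ≅ k[Z₀..Z_n]/𝔭` with `𝔭` of height one (`trdeg_k K = n`, `n + 1`
letters generating `K`), and the kernel criterion for regularity at the centre prime `𝔮 ⊇ 𝔭` is a **JACOBIAN UNIT**: some polynomial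
relation `G ∈ 𝔭` (e.g. the strict transform of the torsor equation `T^p − f` in the chart) has a partial `∂G/∂Z_j` whose value at `z`
is a UNIT of `O`.

PROOF OF (E1) `isRegularLocalRing_locAtCentre_of_jacobianUnit`. `ψ : k[Z] ↠ k[z] = B`, `𝔮_B` the centre prime of `B`, `Q = ψ⁻¹ 𝔮_B`,
`L = k[Z]_Q` (regular local, Mathlib), `L_B = B_{𝔮_B} ≅ locAtCentre B O` (tree `locAtCentreEquiv`). (§1) `G ∉ 𝔪_L²`: else `uG ∈ Q²` for
some `u ∉ Q`, and `∂_j(uG) = u ∂_j G + G ∂_j u ∈ Q` forces `∂_j G ∈ Q` (`algebraMap_not_mem_sq_maximalIdeal`). (§2) `L ⧸ (G)` is regular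
of dimension `dim L − 1` (tree `IsRegularLocalRing.quotient_span_singleton`), so `𝔪_L = (G, g₂, …, g_d)` with `d = dim L`
(`exists_span_insert_of_quotient`); the local map `π : L ↠ L_B` (`Localization.localRingHom`, surjective because `ψ` is) kills `G` and maps
`𝔪_L` ONTO `𝔪_{L_B}`, hence `𝔪_{L_B}` needs `≤ d − 1` generators (`spanFinrank_map_le_of_span_insert`). (§3) `dim L_B = d − 1`: the affine
dimension formula (tree `ringKrullDim_quotient_add_height`) in `k[Z]` (`dim = n + 1`) and in `B` (`dim = trdeg_k K = n`,
`ringKrullDim_adjoin_eq`) with `k[Z]/Q ≅ B/𝔮_B` gives `ht Q = ht 𝔮_B + 1`. (§4) `spanFinrank 𝔪_{L_B} ≤ dim L_B` ⇒ regular (Mathlib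
`IsRegularLocalRing.of_spanFinrank_maximalIdeal_le`). No characteristic / perfectness / residue-field / zero-dimensionality hypothesis.
PART 2 (`…Theorems.FrobeniusClosingSteerToricExitProducer`): (E2) `concl_of_jacobianUnit` = (E1) + the `locAtCentre` sandwich
`concl_of_regular_locAtCentre` (any f.g. `A₀` and `t` inside `locAtCentre k[z] O` get `Concl O A₀ t`); (E3) `toricExitAt_of_jacobianUnit` =
the BODY of `ToricExitAt O R s n N` VERBATIM for a monomial-type member, by (E1) and the sandwich `k[z] ≤ (R N)[s N][z] ≤ locAtCentre k[z] O`.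
Differences from the statement file: (E1)/(E2) index the letters by `Fin (n+1)` with `trdeg_k K = n` (instead of `Fin N`,
`trdeg + 1 = N`); (E3) carries `s N ≠ 0` explicitly.

NONDEGENERACY ⇒ JACOBIAN UNIT (res-L0-w41-strat-2 §12 (3)/(4); the EDGE lemma (E4) is the next file). With `J₊ = {j : v(z_j) > 0}`,
`J₀ = {j : v(z_j) = 0}`: IF the face of the cone carrying `ω` is SUBORDINATE to the local Newton fan of `F = T^p − f` (one exponent of `F`
minimises all `J₊`-coordinates at once — automatic when that face is a ray, e.g. the EDGE-ADAPTED cones of strat-2's (H2)), the part of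
the strict transform visible at the centre is `in_ω(F)` in the `J₀`-torus coordinates, and torus-nondegeneracy of `in_ω(F)` over the
residue field yields the Jacobian unit; WITHOUT subordination «`in_ω` nondegenerate + any regular cone `∋ ω`» does NOT imply an exit
(tri-3 row R-U, f♭). The Jacobian unit is also exactly res-type-054's U11b test (ii) «regular after adjoining».
[cite: Matsumura1987, Thm. 14.2, Thm. 5.6] [cite: Teissier2014] [folklore]
-/

noncomputable section

-- single-problem summit: the doubled namespace component `ResolutionOfSingularities` is forced
set_option linter.dupNamespace false

open scoped BigOperators

namespace Summit.ResolutionOfSingularities.ResolutionOfSingularities.Theorems.SteerToricExitCriterion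

open IsLocalRing MvPolynomial
open Literature.AlgebraicGeometry.Resolution

variable {k : Type} [Field k]

/-! ## §1 Derivative bookkeeping: an element of `𝔮²` has all partial derivatives in `𝔮` -/

/-- For ANY ideal `Q` of a polynomial ring: `h ∈ Q² ⇒ ∂_j h ∈ Q` (Leibniz). [folklore] -/
theorem pderiv_mem_of_mem_sq {σ : Type} (Q : Ideal (MvPolynomial σ k)) (j : σ) {h : MvPolynomial σ k}
    (hh : h ∈ Q ^ 2) : pderiv j h ∈ Q := by
  rw [pow_two] at hh
  refine Submodule.mul_induction_on hh (fun a ha b hb => ?_) (fun x y hx hy => ?_)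
  · -- `∂(ab) = a ∂b + b ∂a`
    rw [Derivation.leibniz, smul_eq_mul, smul_eq_mul]
    exact Q.add_mem (Q.mul_mem_right _ ha) (Q.mul_mem_right _ hb)
  · rw [map_add]
    exact Q.add_mem hx hy

/-- At a prime `Q`: if `G ∈ Q` has `∂_j G ∉ Q`, then no `u ∉ Q` has `u · G ∈ Q²` (`∂_j(uG) = u ∂_j G + G ∂_j u`). [folklore] -/
theorem not_mul_mem_sq_of_pderiv_not_mem {σ : Type} (Q : Ideal (MvPolynomial σ k)) [Q.IsPrime] (j : σ)
    {G u : MvPolynomial σ k} (hG : G ∈ Q) (hD : pderiv j G ∉ Q) (hu : u ∉ Q) : u * G ∉ Q ^ 2 := by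
  intro h
  have h1 : pderiv j (u * G) ∈ Q := pderiv_mem_of_mem_sq Q j h
  rw [Derivation.leibniz, smul_eq_mul, smul_eq_mul] at h1
  -- `u ∂G + G ∂u ∈ Q`, `G ∂u ∈ Q` ⇒ `u ∂G ∈ Q` ⇒ `∂G ∈ Q`
  have h2 : u * pderiv j G ∈ Q := by
    have h3 : G * pderiv j u ∈ Q := Q.mul_mem_right _ hG
    have := Q.sub_mem h1 h3
    rwa [add_sub_cancel_right] at this
  rcases (Ideal.IsPrime.mem_or_mem ‹Q.IsPrime› h2) with h4 | h4
  · exact hu h4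
  · exact hD h4

/-- **Jacobian unit ⇒ `G ∉ 𝔪²` in the local ring `k[Z]_Q`**: if `G ∈ Q` and `∂_j G ∉ Q` for a prime `Q` of `k[Z]`, then the image of
`G` in `Localization.AtPrime Q` is not in the square of the maximal ideal (clear denominators and use
`not_mul_mem_sq_of_pderiv_not_mem`). [folklore] -/
theorem algebraMap_not_mem_sq_maximalIdeal {σ : Type} (Q : Ideal (MvPolynomial σ k)) [Q.IsPrime] (j : σ)
    {G : MvPolynomial σ k} (hG : G ∈ Q) (hD : pderiv j G ∉ Q) :
    algebraMap (MvPolynomial σ k) (Localization.AtPrime Q) G ∉ maximalIdeal (Localization.AtPrime Q) ^ 2 := by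
  intro h
  rw [← Localization.AtPrime.map_eq_maximalIdeal, ← Ideal.map_pow,
    IsLocalization.mem_map_algebraMap_iff Q.primeCompl] at h
  obtain ⟨⟨⟨i, hi⟩, ⟨u, hu⟩⟩, hiu⟩ := h
  -- `G · u = i` in `k[Z]` (the localisation map is injective on the domain `k[Z]`)
  have hinj : Function.Injective (algebraMap (MvPolynomial σ k) (Localization.AtPrime Q)) :=
    IsLocalization.injective _ Q.primeCompl_le_nonZeroDivisors
  have hGu : G * u = i := by
    apply hinj
    simpa [map_mul] using hiu
  have : u * G ∈ Q ^ 2 := by rw [mul_comm, hGu]; exact hi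
  exact not_mul_mem_sq_of_pderiv_not_mem Q j hG hD hu this

/-! ## §2 Generator bookkeeping: killing one generator lowers `spanFinrank` of the image ideal -/

/-- If `I = span (insert g S)` with `S` finite and `f g = 0`, then `spanFinrank (I.map f) ≤ #S`. [folklore] -/
theorem spanFinrank_map_le_of_span_insert {R S : Type*} [CommRing R] [CommRing S] (f : R →+* S) {I : Ideal R}
    {g : R} {T : Finset R} (hI : I = Ideal.span (insert g (T : Set R))) (hg : f g = 0) :
    (I.map f).spanFinrank ≤ T.card := by
  classical
  have hmap : I.map f = Ideal.span ((T.image f : Finset S) : Set S) := by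
    rw [hI, Ideal.map_span, Set.image_insert_eq, hg, Finset.coe_image]
    exact Ideal.span_insert_zero
  rw [hmap]
  calc (Ideal.span ((T.image f : Finset S) : Set S)).spanFinrank ≤ ((T.image f : Finset S) : Set S).ncard :=
        Submodule.spanFinrank_span_le_ncard_of_finite (Finset.finite_toSet _)
    _ = (T.image f).card := by rw [Set.ncard_coe_finset]
    _ ≤ T.card := Finset.card_image_le

/-- In a local ring: if `G ∈ 𝔪` and `𝔪/(G)` (the maximal ideal of `R ⧸ (G)`) is generated by `c` elements, then `𝔪 = span (insert G T)`
for some `T` with `#T ≤ c`. [folklore] -/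
theorem exists_span_insert_of_quotient {R : Type*} [CommRing R] [IsLocalRing R] {G : R} (hG : G ∈ maximalIdeal R)
    [IsLocalRing (R ⧸ Ideal.span {G})] {c : ℕ}
    (hc : (maximalIdeal (R ⧸ Ideal.span {G})).spanFinrank ≤ c)
    (hfg : (maximalIdeal (R ⧸ Ideal.span {G})).FG) :
    ∃ T : Finset R, T.card ≤ c ∧ maximalIdeal R = Ideal.span (insert G (T : Set R)) := by
  classical
  obtain ⟨s, hscard, hsspan⟩ := Submodule.FG.exists_span_finset_card_eq_spanFinrank hfg
  haveI hloc : IsLocalHom (Ideal.Quotient.mk (Ideal.span {G})) :=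
    IsLocalHom.of_surjective _ Ideal.Quotient.mk_surjective
  -- lift the generators
  have hlift : ∀ x : R ⧸ Ideal.span {G}, ∃ y : R, Ideal.Quotient.mk _ y = x := Ideal.Quotient.mk_surjective
  choose lift hlift using hlift
  refine ⟨s.image lift, (Finset.card_image_le).trans (hscard ▸ hc), le_antisymm ?_ ?_⟩
  · intro x hx
    -- `mk x ∈ 𝔪' = span s`: write it on the generators and pull back modulo `(G)`
    have hmk : Ideal.Quotient.mk (Ideal.span {G}) x ∈ Submodule.span (R ⧸ Ideal.span {G}) (s : Set (R ⧸ Ideal.span {G})) := by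
      rw [hsspan]
      exact map_nonunit (Ideal.Quotient.mk (Ideal.span {G})) x hx
    obtain ⟨c, -, hc⟩ := Submodule.mem_span_finset.mp hmk
    set y : R := ∑ i ∈ s, lift (c i) * lift i with hy
    have hxy : x - y ∈ Ideal.span {G} := by
      rw [← Ideal.Quotient.eq_zero_iff_mem, map_sub, sub_eq_zero, hy, map_sum, ← hc]
      refine Finset.sum_congr rfl fun i _ => ?_
      rw [map_mul, hlift, hlift, smul_eq_mul]
    have hyT : y ∈ Ideal.span (insert G ((s.image lift : Finset R) : Set R)) := by
      refine Ideal.sum_mem _ fun i hi => Ideal.mul_mem_left _ _ (Ideal.subset_span (Set.mem_insert_of_mem _ ?_))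
      rw [Finset.coe_image]
      exact ⟨i, hi, rfl⟩
    have hGT : x - y ∈ Ideal.span (insert G ((s.image lift : Finset R) : Set R)) :=
      Ideal.span_mono (Set.singleton_subset_iff.mpr (Set.mem_insert _ _)) hxy
    have := Ideal.add_mem _ hGT hyT
    rwa [sub_add_cancel] at this
  · rw [Ideal.span_le]
    rintro y (rfl | hy)
    · exact hG
    · rw [Finset.coe_image] at hy
      obtain ⟨x, hx, rfl⟩ := hy
      have hxm : (x : R ⧸ Ideal.span {G}) ∈ maximalIdeal (R ⧸ Ideal.span {G}) := by
        rw [← hsspan]; exact Submodule.subset_span hx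
      -- a non-unit upstairs lifts to a non-unit (local hom)
      change lift x ∈ maximalIdeal R
      rw [mem_maximalIdeal, mem_nonunits_iff]
      intro hunit
      have : IsUnit (Ideal.Quotient.mk (Ideal.span {G}) (lift x)) := hunit.map _
      rw [hlift] at this
      exact (mem_maximalIdeal _ |>.mp hxm) this


/-! ## §3 Dimension bookkeeping for the presentation `k[Z] ↠ k[z]` -/

section Main

variable {K : Type} [Field K] [Algebra k K]

/-- `dim k[z] = trdeg_k K` (read in `ℕ`) when `k(z) = K` and `trdeg_k K = n`. [cite: Matsumura1987, Thm. 5.6] -/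
theorem ringKrullDim_adjoin_eq {N : ℕ} (z : Fin N → K) (hzK : IntermediateField.adjoin k (Set.range z) = ⊤)
    {n : ℕ} (htr : Algebra.trdeg k K = n) :
    ringKrullDim (Algebra.adjoin k (Set.range z)) = (n : WithBot ℕ∞) := by
  classical
  set B : Subalgebra k K := Algebra.adjoin k (Set.range z)
  haveI : Algebra.FiniteType k B := by
    rw [← Subalgebra.fg_iff_finiteType]
    refine ⟨Finset.univ.image z, ?_⟩
    rw [Finset.coe_image, Finset.coe_univ, Set.image_univ]
  haveI : IsFractionRing B K := SteerToricConcl.isFractionRing_adjoin_of_adjoin_eq_top z hzK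
  rw [Literature.RingTheory.KrullDimension.ringKrullDim_eq_trdeg k B, ← trdeg_eq_trdeg_of_isFractionRing B, htr,
    Cardinal.toNat_natCast]

/-! ## §4 (E1) the hypersurface-chart lemma -/

/-- **(E1) HYPERSURFACE-CHART LEMMA.** `k ≤ O`; `z : Fin (n+1) → K` in `O` generating `K` as a field, `trdeg_k K = n` (ONE relation
among the letters); `G ∈ k[Z₀..Z_n]` with `G(z) = 0` and a JACOBIAN UNIT: some `∂G/∂Z_j` evaluates at `z` to a unit of `O`
(`O.valuation _ = 1`). Then the local ring `locAtCentre k[z] O` of `k[z]` at the centre of `O` is a regular local ring: with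
`𝔮 ⊇ 𝔭 = ker (k[Z] → K)` the centre prime, `G ∉ 𝔮²k[Z]_𝔮` (`algebraMap_not_mem_sq_maximalIdeal`), so `k[Z]_𝔮/(G)` is regular of dimension
`ht 𝔮 − 1` and its maximal ideal needs `ht 𝔮 − 1` generators; `k[Z]_𝔮 ↠ k[z]_𝔮` kills `G`, so `𝔪(k[z]_𝔮)` needs `≤ ht 𝔮 − 1 = dim k[z]_𝔮`
generators (affine dimension formula twice: `ht 𝔮 = ht 𝔮̄ + 1` because `dim k[z] = n = dim k[Z] − 1`). OURS. [cite: Matsumura1987, Thm. 14.2, Thm. 5.6]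
[folklore] -/
theorem isRegularLocalRing_locAtCentre_of_jacobianUnit (O : ValuationSubring K) (hk : ∀ c : k, algebraMap k K c ∈ O)
    {n : ℕ} (z : Fin (n + 1) → K) (hzO : ∀ j, z j ∈ O)
    (hzK : IntermediateField.adjoin k (Set.range z) = ⊤) (htr : Algebra.trdeg k K = n)
    (G : MvPolynomial (Fin (n + 1)) k) (hG : MvPolynomial.aeval z G = 0)
    (hJ : ∃ j, O.valuation (MvPolynomial.aeval z (MvPolynomial.pderiv j G)) = 1) :
    IsRegularLocalRing (locAtCentre (Algebra.adjoin k (Set.range z)).toSubring O) := by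
  classical
  obtain ⟨j, hj⟩ := hJ
  -- ### the chart ring `B = k[z] ⊆ O`, its centre prime `qB`, the presentation `ψ : k[Z] ↠ B` and `Q := ψ⁻¹ qB`
  set B : Subalgebra k K := Algebra.adjoin k (Set.range z) with hBdef
  have hBO : B.toSubring ≤ O.toSubring :=
    adjoin_toSubring_le_of_subset_valuationSubring O hk (Set.range_subset_iff.mpr hzO)
  rw [isRegularLocalRing_locAtCentre_iff hBO]
  set qB : Ideal B.toSubring := subringCentre B.toSubring O hBO with hqBdef
  haveI hqBp : qB.IsPrime := by rw [hqBdef, subringCentre]; exact Ideal.IsPrime.comap _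
  have hrange : ∀ g : MvPolynomial (Fin (n + 1)) k, aeval z g ∈ B.toSubring := fun g => by
    change aeval z g ∈ B
    rw [hBdef, Algebra.adjoin_range_eq_range_aeval]; exact ⟨g, rfl⟩
  set ψ : MvPolynomial (Fin (n + 1)) k →+* B.toSubring :=
    (aeval z : MvPolynomial (Fin (n + 1)) k →ₐ[k] K).toRingHom.codRestrict B.toSubring hrange with hψdef
  have hψ : ∀ g : MvPolynomial (Fin (n + 1)) k, ((ψ g : B.toSubring) : K) = aeval z g := fun g => rfl
  have hψsurj : Function.Surjective ψ := by
    rintro ⟨b, hb⟩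
    have hb' : b ∈ (aeval z : MvPolynomial (Fin (n + 1)) k →ₐ[k] K).range := by
      rw [← Algebra.adjoin_range_eq_range_aeval]; exact hb
    obtain ⟨g, hg⟩ := hb'
    exact ⟨g, Subtype.ext hg⟩
  set Q : Ideal (MvPolynomial (Fin (n + 1)) k) := Ideal.comap ψ qB with hQdef
  haveI hQp : Q.IsPrime := Ideal.IsPrime.comap _
  have hmemQ : ∀ g : MvPolynomial (Fin (n + 1)) k, g ∈ Q ↔ O.valuation (aeval z g) < 1 := fun g => by
    rw [hQdef, Ideal.mem_comap, hqBdef, mem_subringCentre_iff]; rfl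
  have hGQ : G ∈ Q := by rw [hmemQ, hG, map_zero]; exact zero_lt_one
  have hDQ : pderiv j G ∉ Q := by rw [hmemQ, hj]; exact lt_irrefl _
  -- ### the regular local ring `L = k[Z]_Q` and its regular quotient `L ⧸ (G)`
  set L := Localization.AtPrime Q
  haveI : IsRegularLocalRing L := inferInstance
  have hGL : algebraMap (MvPolynomial (Fin (n + 1)) k) L G ∈ maximalIdeal L := (IsLocalization.AtPrime.to_map_mem_maximal_iff L Q G).mpr hGQ
  have hGL2 : algebraMap (MvPolynomial (Fin (n + 1)) k) L G ∉ maximalIdeal L ^ 2 := algebraMap_not_mem_sq_maximalIdeal Q j hGQ hDQ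
  obtain ⟨hregL', hdimL'⟩ := IsRegularLocalRing.quotient_span_singleton hGL hGL2
  haveI : IsLocalRing (L ⧸ Ideal.span {algebraMap (MvPolynomial (Fin (n + 1)) k) L G}) := hregL'.toIsLocalRing
  haveI : IsNoetherianRing (L ⧸ Ideal.span {algebraMap (MvPolynomial (Fin (n + 1)) k) L G}) := inferInstance
  -- `𝔪_L = span (insert G T)` with `#T ≤ spanFinrank 𝔪_{L/(G)} = dim L/(G)`
  obtain ⟨T, hTcard, hT⟩ := exists_span_insert_of_quotient hGL le_rfl
    (maximalIdeal (L ⧸ Ideal.span {algebraMap (MvPolynomial (Fin (n + 1)) k) L G})).fg_of_isNoetherianRing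
  -- ### the surjection `π : L → LB = B_{qB}` kills `G`, so `𝔪_{LB}` needs `≤ #T` generators
  set LB := Localization.AtPrime qB
  set π : L →+* LB := Localization.localRingHom Q qB ψ rfl with hπdef
  have hπG : π (algebraMap (MvPolynomial (Fin (n + 1)) k) L G) = 0 := by
    rw [hπdef, Localization.localRingHom_to_map]
    have : ψ G = 0 := Subtype.ext (by rw [hψ, hG]; rfl)
    rw [this, map_zero]
  have hπsurj : Function.Surjective π := by
    intro w
    obtain ⟨⟨a, b⟩, rfl⟩ := IsLocalization.mk'_surjective qB.primeCompl w
    obtain ⟨ga, rfl⟩ := hψsurj a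
    obtain ⟨gb, hgb⟩ := hψsurj b.1
    have hgbQ : gb ∉ Q := fun h => b.2 (by
      have h' : ψ gb ∈ qB := Ideal.mem_comap.mp h
      rwa [hgb] at h')
    refine ⟨IsLocalization.mk' L ga (⟨gb, hgbQ⟩ : Q.primeCompl), ?_⟩
    rw [hπdef, Localization.localRingHom_mk']
    congr 1
    exact Subtype.ext hgb
  have hmax : maximalIdeal LB = (maximalIdeal L).map π := by
    refine le_antisymm (fun w hw => ?_) (Ideal.map_le_iff_le_comap.mpr fun x hx => ?_)
    · obtain ⟨ℓ, rfl⟩ := hπsurj w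
      by_cases hℓ : ℓ ∈ maximalIdeal L
      · exact Ideal.mem_map_of_mem π hℓ
      · exfalso
        have hu : IsUnit ℓ := by rwa [mem_maximalIdeal, mem_nonunits_iff, not_not] at hℓ
        exact (mem_maximalIdeal _ |>.mp hw) (hu.map π)
    · exact map_nonunit π x hx
  have hspan : (maximalIdeal LB).spanFinrank ≤ T.card := by
    rw [hmax]
    exact spanFinrank_map_le_of_span_insert π hT hπG
  -- ### dimensions: `dim LB = ht qB`, `dim L = ht Q`, `ht Q = ht qB + 1`
  -- the affine domain `T = k[z]` (as the subring type) and its dimension `n`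
  letI : Algebra k B.toSubring := B.algebra
  have hBfg : B.FG := by
    refine ⟨Finset.univ.image z, ?_⟩
    rw [Finset.coe_image, Finset.coe_univ, Set.image_univ]
  haveI : Algebra.FiniteType k B.toSubring := (Subalgebra.fg_iff_finiteType _).mp hBfg
  haveI : IsNoetherianRing B.toSubring := Algebra.FiniteType.isNoetherianRing k _
  have hdimT : ringKrullDim B.toSubring = (n : WithBot ℕ∞) := by
    have e₁ : (B : Subalgebra k K) ≃+* B.toSubring :=
      { toFun := fun a => ⟨a.1, a.2⟩
        invFun := fun a => ⟨a.1, a.2⟩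
        left_inv := fun _ => rfl
        right_inv := fun _ => rfl
        map_mul' := fun _ _ => rfl
        map_add' := fun _ _ => rfl }
    rw [← ringKrullDim_eq_of_ringEquiv e₁]
    exact ringKrullDim_adjoin_eq z hzK htr
  have hdimP : ringKrullDim (MvPolynomial (Fin (n + 1)) k) = ((n + 1 : ℕ) : WithBot ℕ∞) := by
    rw [MvPolynomial.ringKrullDim_of_isNoetherianRing, ringKrullDim_eq_zero_of_field, zero_add, Nat.card_eq_fintype_card,
      Fintype.card_fin]
  -- the two dimension formulas
  have hfP := Literature.RingTheory.KrullDimension.ringKrullDim_quotient_add_height k Q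
  have hfT := Literature.RingTheory.KrullDimension.ringKrullDim_quotient_add_height k qB
  -- `k[Z] ⧸ Q ≅ T ⧸ qB`
  have hθsurj : Function.Surjective ((Ideal.Quotient.mk qB).comp ψ) :=
    Ideal.Quotient.mk_surjective.comp hψsurj
  have hkerθ : RingHom.ker ((Ideal.Quotient.mk qB).comp ψ) = Q := by
    rw [← RingHom.comap_ker, Ideal.mk_ker]
  have hdimQ : ringKrullDim (MvPolynomial (Fin (n + 1)) k ⧸ Q) = ringKrullDim (B.toSubring ⧸ qB) :=
    ringKrullDim_eq_of_ringEquiv ((Ideal.quotEquivOfEq hkerθ.symm).trans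
      (RingHom.quotientKerEquivOfSurjective hθsurj))
  -- finiteness of the quantities
  obtain ⟨a, ha, -⟩ := Literature.RingTheory.KrullDimension.exists_ringKrullDim_eq_and_trdeg_eq k (B.toSubring ⧸ qB)
  have hQfin : ∃ i : ℕ, Q.height = i := by
    have hle := Ideal.height_le_ringKrullDim_of_ne_top (Ideal.IsPrime.ne_top hQp)
    rw [hdimP] at hle
    have hle' : Q.height ≤ (n + 1 : ℕ) := by exact_mod_cast hle
    exact ⟨_, (ENat.coe_toNat (ne_top_of_le_ne_top (ENat.coe_ne_top _) hle')).symm⟩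
  have hqfin : ∃ i : ℕ, qB.height = i := by
    have hle := Ideal.height_le_ringKrullDim_of_ne_top (Ideal.IsPrime.ne_top hqBp)
    rw [hdimT] at hle
    have hle' : qB.height ≤ (n : ℕ) := by exact_mod_cast hle
    exact ⟨_, (ENat.coe_toNat (ne_top_of_le_ne_top (ENat.coe_ne_top _) hle')).symm⟩
  obtain ⟨i, hi⟩ := hQfin
  obtain ⟨i', hi'⟩ := hqfin
  rw [hdimQ, ha, hi, hdimP] at hfP
  rw [ha, hi', hdimT] at hfT
  have h1 : a + i = n + 1 := by
    have : ((a + i : ℕ) : WithBot ℕ∞) = ((n + 1 : ℕ) : WithBot ℕ∞) := by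
      rw [← hfP]; push_cast; rfl
    exact_mod_cast this
  have h2 : a + i' = n := by
    have : ((a + i' : ℕ) : WithBot ℕ∞) = ((n : ℕ) : WithBot ℕ∞) := by
      rw [← hfT]; push_cast; rfl
    exact_mod_cast this
  have hii' : i = i' + 1 := by omega
  -- `dim L = i`, `dim LB = i'`, `dim L' = i - 1 = i'`
  have hdimL : ringKrullDim L = (i : WithBot ℕ∞) := by
    rw [IsLocalization.AtPrime.ringKrullDim_eq_height Q L, hi]; rfl
  have hdimLB : ringKrullDim LB = (i' : WithBot ℕ∞) := by
    rw [IsLocalization.AtPrime.ringKrullDim_eq_height qB LB, hi']; rfl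
  have hdimL'' : ringKrullDim (L ⧸ Ideal.span {algebraMap (MvPolynomial (Fin (n + 1)) k) L G}) = (i' : WithBot ℕ∞) := by
    obtain ⟨d, hd⟩ := exists_nat_cast_eq_ringKrullDim (R := L ⧸ Ideal.span {algebraMap (MvPolynomial (Fin (n + 1)) k) L G})
    rw [hd, hdimL] at hdimL'
    have : d + 1 = i := by
      have : ((d + 1 : ℕ) : WithBot ℕ∞) = ((i : ℕ) : WithBot ℕ∞) := by rw [← hdimL']; push_cast; rfl
      exact_mod_cast this
    rw [hd]
    congr 1
    exact_mod_cast (by omega : d = i')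
  have hsfL' : ((maximalIdeal (L ⧸ Ideal.span {algebraMap (MvPolynomial (Fin (n + 1)) k) L G})).spanFinrank : WithBot ℕ∞) =
      (i' : WithBot ℕ∞) := by
    rw [(isRegularLocalRing_iff _).mp hregL', hdimL'']
  have hTi : T.card ≤ i' := by
    have : ((T.card : ℕ) : WithBot ℕ∞) ≤ (i' : WithBot ℕ∞) := by
      rw [← hsfL']; exact_mod_cast hTcard
    exact_mod_cast this
  -- ### conclusion: `spanFinrank 𝔪_{LB} ≤ i' = dim LB`
  haveI : IsNoetherianRing LB := inferInstance
  refine IsRegularLocalRing.of_spanFinrank_maximalIdeal_le LB ?_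
  rw [hdimLB]
  exact_mod_cast hspan.trans hTi

end Main

end Summit.ResolutionOfSingularities.ResolutionOfSingularities.Theorems.SteerToricExitCriterion

end
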